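import Mathlib.NumberTheory.Primorial
import Literature.NumberTheory.Sieve.AletheiaZomleferFukshanskyGarcia2020Applications
import Literature.NumberTheory.Sieve.AletheiaZomleferFukshanskyGarcia2020CunninghamProofs
import HarnessLib

/-!
# Aletheia-Zomlefer–Fukshansky–Garcia (2020), §7.5: the Green–Tao theorem from Bateman–Horn — proof

Discharge of the named fact `Literature.NumberTheory.Sieve.greenTao_of_batemanHorn` of
`AletheiaZomleferFukshanskyGarcia2020Applications.lean` (§7.5, Theorem 7.5.1 from Bateman–Horn):
the Bateman–Horn conjecture implies that the primes contain arbitrarily long arithmetic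
progressions (`exists_prime_arithmetic_progression`).

We follow the source: for `k ≥ 1` take `fᵢ(t) = t + i a`, `0 ≤ i < k`, with `a = k#` the
primorial (the source writes `f_i(t) = t + (i-1)a`, `a = p_k#`, `1 ≤ i ≤ k`; any positive `a`
divisible by every prime `p ≤ k` works and `k#` is one).  Each `fᵢ` is monic of degree one, hence
irreducible with positive leading coefficient; `fᵢ`, `fⱼ` are not associated for `i ≠ j`; and
there is no fixed prime divisor: for `p ≤ k`, `p ∣ a` and `∏ fᵢ(1) ≡ 1 (mod p)`, while for
`p > k` the `k < p` residues `-i a (mod p)` do not exhaust `ℤ/p` ("`ω_f(p) = 1` if `p ∣ a`,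
`≤ k` if `p ∤ a`").  The qualitative content of the conjecture
(`BatemanHornConjecture.setOf_forall_prime_infinite`, which packages the PROVED positivity of
the Bateman–Horn constant) then gives infinitely many `n` with `n, n + a, …, n + (k-1)a` all
prime.

## References
* [AletheiaZomleferFukshanskyGarcia2020] S. L. Aletheia-Zomlefer, L. Fukshansky, S. R. Garcia,
  *The Bateman–Horn conjecture: heuristics, history, and applications*, Expo. Math. 38 (2020)
  430–479, arXiv:1807.08899, §7.5 Theorem 7.5.1.
-/

noncomputable section

open Finset Polynomial

namespace Literature.NumberTheory.Sieve

/-! ### §7.5 — the arithmetic-progression system -/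

/-- The system of §7.5 is `fᵢ(t) = t + i · k#` for `i < k` (`k#` the primorial), written
inline below as `fun i : Fin k ↦ X + C (i · k#)`; here its values: `fᵢ(n) = n + i · k#`.
[cite: AletheiaZomleferFukshanskyGarcia2020, §7.5 (f_i(t) = t + (i-1)a, a = p_k#)] -/
theorem apSystem_eval_natCast (k : ℕ) (i : Fin k) (n : ℕ) :
    (X + C ((((i : ℕ) * primorial k : ℕ) : ℤ)) : ℤ[X]).eval (n : ℤ)
      = ((n + (i : ℕ) * primorial k : ℕ) : ℤ) := by
  simp

/-- **§7.5 (implicit)**: the arithmetic-progression system satisfies the Bateman–Horn hypotheses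
("`ω_f(p) = 1` if `p ∣ a` and `min {k, p}`-many roots otherwise", so `ω_f(p) < p` as `p ∣ k#`
for `p ≤ k`). [cite: AletheiaZomleferFukshanskyGarcia2020, §7.5 Theorem 7.5.1 (the system)] -/
theorem isBatemanHornSystem_apSystem (k : ℕ) :
    IsBatemanHornSystem (fun i : Fin k ↦ (X + C ((((i : ℕ) * primorial k : ℕ) : ℤ)) : ℤ[X])) where
  irreducible i := by
    simpa using irreducible_X_sub_C (-((((i : ℕ) * primorial k : ℕ) : ℤ)))
  leadingCoeff_pos i := by
    show 0 < (X + C ((((i : ℕ) * primorial k : ℕ) : ℤ)) : ℤ[X]).leadingCoeff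
    rw [(monic_X_add_C _).leadingCoeff]
    exact one_pos
  pairwise_not_associated := by
    intro i j hij hassoc
    obtain ⟨u, hu⟩ := hassoc
    obtain ⟨r, hr, hru⟩ := Polynomial.isUnit_iff.mp u.isUnit
    have h1 := congrArg (fun g : ℤ[X] ↦ g.coeff 1) hu
    have h0 := congrArg (fun g : ℤ[X] ↦ g.coeff 0) hu
    simp only [← hru, coeff_mul_C, coeff_add, coeff_X_one, coeff_C_succ, add_zero,
      coeff_X_zero, coeff_C_zero, zero_add] at h1 h0
    rw [one_mul] at h1
    rw [h1, mul_one] at h0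
    have ha : 0 < primorial k := primorial_pos k
    refine hij (Fin.ext ?_)
    have : (i : ℕ) * primorial k = (j : ℕ) * primorial k := by exact_mod_cast h0
    exact Nat.eq_of_mul_eq_mul_right ha this
  hasNoFixedPrimeDivisor p hp := by
    have hpZ : _root_.Prime (p : ℤ) := Nat.prime_iff_prime_int.mp hp
    unfold polyRootCountMod
    -- a residue `m < p` at which no `fᵢ` vanishes modulo `p`
    obtain ⟨m, hmp, hm⟩ : ∃ m ∈ range p, ∀ i : Fin k,
        ¬ (p : ℤ) ∣ (X + C ((((i : ℕ) * primorial k : ℕ) : ℤ)) : ℤ[X]).eval (m : ℤ) := by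
      by_cases hpk : p ≤ k
      · -- `p ∣ k#`: take `m = 1`, `fᵢ(1) ≡ 1 (mod p)`
        refine ⟨1, mem_range.2 hp.one_lt, fun i hi ↦ ?_⟩
        rw [apSystem_eval_natCast] at hi
        have hdvd : (p : ℤ) ∣ (((i : ℕ) * primorial k : ℕ) : ℤ) := by
          exact_mod_cast (dvd_mul_of_dvd_right ((Nat.Prime.dvd_primorial_iff hp).2 hpk) _)
        refine hpZ.not_dvd_one ?_
        have := dvd_sub hi hdvd
        convert this using 1
        push_cast
        ring
      · -- `p > k`: the `k` residues `-i a (mod p)` do not cover `range p`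
        push Not at hpk
        haveI : NeZero p := ⟨hp.ne_zero⟩
        let B : Finset ℕ := (univ : Finset (Fin k)).image
          fun i : Fin k ↦ ((-((((i : ℕ) * primorial k : ℕ) : ℤ)) : ZMod p)).val
        have hB : B.card < (range p).card := by
          rw [card_range]
          exact (card_image_le.trans_eq (by simp)).trans_lt hpk
        obtain ⟨m, hm, hmB⟩ := exists_mem_notMem_of_card_lt_card hB
        refine ⟨m, hm, fun i hi ↦ hmB ?_⟩
        rw [apSystem_eval_natCast] at hi
        refine mem_image.2 ⟨i, mem_univ _, ?_⟩
        have hmz : ((m : ℤ) : ZMod p) = -((((i : ℕ) * primorial k : ℕ) : ℤ) : ZMod p) := by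
          rw [eq_neg_iff_add_eq_zero]
          have := (ZMod.intCast_zmod_eq_zero_iff_dvd _ p).2 hi
          push_cast at this ⊢
          exact this
        have : ((-((((i : ℕ) * primorial k : ℕ) : ℤ)) : ZMod p)) = (m : ZMod p) := by
          push_cast at hmz ⊢
          rw [hmz]
        rw [this, ZMod.val_natCast, Nat.mod_eq_of_lt (mem_range.1 hm)]
    calc #((range p).filter fun n : ℕ ↦ (p : ℤ) ∣
          ∏ i : Fin k, (X + C ((((i : ℕ) * primorial k : ℕ) : ℤ)) : ℤ[X]).eval (n : ℤ))
        < #(range p) := by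
          refine card_lt_card (filter_ssubset.mpr ⟨m, hmp, ?_⟩)
          exact hpZ.not_dvd_finsetProd fun i _ hi ↦ hm i hi
      _ = p := card_range p

/-! ### §7.5 — the discharge -/

/-- **§7.5, Theorem 7.5.1 from Bateman–Horn — discharged**: the Bateman–Horn conjecture
implies that the primes contain arbitrarily long arithmetic progressions.  Apply the conjecture
(its qualitative content `BatemanHornConjecture.setOf_forall_prime_infinite`, positivity of the
constant being the proved convergence theorem) to the system `t + i·k#`, `i < k`
(`isBatemanHornSystem_apSystem`): some (indeed infinitely many) `n` make
`n, n + k#, …, n + (k-1)k#` simultaneously prime.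
[cite: AletheiaZomleferFukshanskyGarcia2020, §7.5 Theorem 7.5.1] -/
theorem greenTao_of_batemanHorn_holds : greenTao_of_batemanHorn := by
  intro hBH k
  obtain ⟨n, hn⟩ := (hBH.setOf_forall_prime_infinite (isBatemanHornSystem_apSystem k)).nonempty
  refine ⟨n, primorial k, primorial_pos k, fun i hi ↦ ?_⟩
  have h := (hn ⟨i, hi⟩).2
  rwa [apSystem_eval_natCast, Int.toNat_natCast] at h

end Literature.NumberTheory.Sieve

end
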